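import Literature.GroupTheory.ArithmeticGroups.SL2Mod8Layer
import HarnessLib

/-!
# The base of the `2`-adic descent: central extensions of `SL₂(ℤ/8)`, II (the elements `d, y, b`)

Continuation of `SL2Mod8Layer` (same setting and notation: `π : E ↠ SL₂(ℤ/8)` central with kernel of exponent
`2`, `t, l` lifts of `T̄, L̄` with `t⁸ = 1`, `u = l²`, `e₀ = t⁴`, `f₀ = l⁴`, `h₁ = t f₀ t⁻¹ f₀⁻¹ e₀`,
`d = [t, u]`, `y = [u, d]`, `b = [t², u]`).  We prove the relations `[t⁴, l²] = 1`, `[t, y] = [u, y] = [d, y] = 1`,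
`[e₀, d] = 1`, `y = b`, `d⁴ = 1`, and the conjugation table `t d t^{∓1} = y d³`, `u d u^{∓1} = y d`,
`t y t⁻¹ = u y u⁻¹ = y`, which say that `D̂ = {dⁱ yʲ}` is normalised by `t, u`.
[CalegariDimitrovTang2025, §4.5, Lemma 4.5.10]; [Beyl1986].
-/

open scoped MatrixGroups commutatorElement

universe u

namespace Literature.GroupTheory.ArithmeticGroups

namespace SL2Mod8

open Matrix.SpecialLinearGroup

variable {E : Type u} [Group E] {π : E →* SL(2, ZMod (2 ^ 3))}

section levelEight

variable (hcen : ∀ z : E, π z = 1 → ∀ g : E, g * z = z * g) (hK2 : ∀ z : E, π z = 1 → z ^ 2 = 1)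
variable {t l e₀ f₀ h₁ : E} (he₀ : e₀ = t ^ 2 ^ (3 - 1)) (hf₀ : f₀ = l ^ 2 ^ (3 - 1))
  (hh₁ : h₁ = t * f₀ * t⁻¹ * f₀⁻¹ * e₀)
  (ht : ((π t : SL(2, ZMod (2 ^ 3))) : Matrix (Fin 2) (Fin 2) (ZMod (2 ^ 3))) = !![1, 1; 0, 1])
  (hl : ((π l : SL(2, ZMod (2 ^ 3))) : Matrix (Fin 2) (Fin 2) (ZMod (2 ^ 3))) = !![1, 0; 1, 1])
  (hτ : t ^ 2 ^ 3 = 1)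

/-! ### The elements `d = [t, u]`, `y = [u, d]`, `b = [t², u]` (`u = l²`) -/

variable {u d y b : E} (hu : u = l ^ 2) (hd : d = ⁅t, u⁆) (hy : y = ⁅u, d⁆) (hb : b = ⁅t ^ 2, u⁆)

include hu hd hy ht hl in
/-- `ȳ = 5·1`. [cite: CalegariDimitrovTang2025, §4.5, Lemma 4.5.10] -/
theorem coe_map_y : ((π y : SL(2, ZMod (2 ^ 3))) : Matrix (Fin 2) (Fin 2) (ZMod (2 ^ 3))) = !![5, 0; 0, 5] := by
  rw [hy, hd, hu, map_commutatorElement, map_commutatorElement, map_pow]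
  exact coe_Y (π t) (π l) ht hl

include hu hb ht hl in
/-- `b̄ = 5·1`. [cite: CalegariDimitrovTang2025, §4.5, Lemma 4.5.10] -/
theorem coe_map_b : ((π b : SL(2, ZMod (2 ^ 3))) : Matrix (Fin 2) (Fin 2) (ZMod (2 ^ 3))) = !![5, 0; 0, 5] := by
  rw [hb, hu, map_commutatorElement, map_pow, map_pow]
  exact coe_B (π t) (π l) ht hl

include he₀ hf₀ hh₁ ht hl in
/-- `h̄₁ = 5·1`. [cite: CalegariDimitrovTang2025, §4.5, Lemma 4.5.10] -/
theorem coe_map_h₁ : ((π h₁ : SL(2, ZMod (2 ^ 3))) : Matrix (Fin 2) (Fin 2) (ZMod (2 ^ 3))) = !![5, 0; 0, 5] := by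
  rw [hh₁, hf₀, e₀_eq he₀, show 2 ^ (3 - 1) = 4 by norm_num]
  simp only [map_mul, map_inv, map_pow]
  exact coe_H (π t) (π l) ht hl

include hcen hu hd hy ht hl in
/-- Commutators with `y` are central (`ȳ` is a central scalar). [cite: Beyl1986, Theorem (Schur multiplier of
SL(2,ℤ/m)), 2-primary part] -/
theorem comm_y_central (g h : E) : h * ⁅g, y⁆ = ⁅g, y⁆ * h :=
  comm_central_of_map_central hcen (fun g' ↦ scalar_comm (π y) (coe_map_y ht hl hu hd hy) g') g h

include hcen hu hb ht hl in
/-- Commutators with `b` are central. [cite: Beyl1986, Theorem (Schur multiplier of SL(2,ℤ/m)), 2-primary part] -/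
theorem comm_b_central (g h : E) : h * ⁅g, b⁆ = ⁅g, b⁆ * h :=
  comm_central_of_map_central hcen (fun g' ↦ scalar_comm (π b) (coe_map_b ht hl hu hb) g') g h

/-- An element over `5·1 = 1 + 4·1` lies over the top layer. [cite: CalegariDimitrovTang2025, §4.5, Lemma 4.5.10] -/
theorem layer_of_coe_five {x : E} (hx : ((π x : SL(2, ZMod (2 ^ 3))) : Matrix (Fin 2) (Fin 2) (ZMod (2 ^ 3))) =
    !![5, 0; 0, 5]) :
    Matrix.SpecialLinearGroup.map (ZMod.castHom (pow_dvd_pow 2 (Nat.sub_le 3 1)) (ZMod (2 ^ (3 - 1)))) (π x) = 1 := by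
  apply SL2TopLayer.map_castHom_eq_one_of_coe 2 3 (π x) (x00 := 1) (x01 := 0) (x10 := 0) (x11 := 1)
  rw [hx]; norm_num

include hcen hK2 he₀ hf₀ hh₁ ht hl hτ hu hb in
/-- `b² = 1`. [cite: Beyl1986, Theorem (Schur multiplier of SL(2,ℤ/m)), 2-primary part] -/
theorem b_sq : b * b = 1 :=
  sq_eq_one_of_layer hcen hK2 he₀ hf₀ hh₁ ht hl hτ (layer_of_coe_five (coe_map_b ht hl hu hb))

include hcen hK2 he₀ hf₀ hh₁ ht hl hτ hu hd hy in
/-- `y² = 1`. [cite: Beyl1986, Theorem (Schur multiplier of SL(2,ℤ/m)), 2-primary part] -/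
theorem y_sq : y * y = 1 :=
  sq_eq_one_of_layer hcen hK2 he₀ hf₀ hh₁ ht hl hτ (layer_of_coe_five (coe_map_y ht hl hu hd hy))

include hcen hK2 he₀ hf₀ hh₁ ht hl hτ hu hb in
/-- **`c₀ = [e₀, u] = [t⁴, l²] = 1`**: `[(t²)², u] = t²[t²,u]t⁻² · [t²,u] = [t², b] b · b = [t, b]² b² = 1`.
[cite: Beyl1986, Theorem (Schur multiplier of SL(2,ℤ/m)), 2-primary part] -/
theorem comm_e₀_u : ⁅e₀, u⁆ = 1 := by
  have hbc := comm_b_central hcen ht hl hu hb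
  have h1 : e₀ = t ^ 2 * t ^ 2 := by rw [e₀_eq he₀, ← pow_add]
  have h2 : t ^ 2 * ⁅t ^ 2, u⁆ * (t ^ 2)⁻¹ = ⁅t ^ 2, b⁆ * b := by rw [← hb, commutatorElement_def (t ^ 2) b]; group
  have h3 : ⁅t ^ 2, b⁆ = 1 := by
    rw [pow_two, comm_mul_left_of_central hbc, ← pow_two]
    exact hK2 _ (by
      rw [map_commutatorElement, commutatorElement_eq_one_iff_mul_comm]
      exact scalar_comm (π b) (coe_map_b ht hl hu hb) (π t))
  rw [h1, comm_mul_left, h2, h3, one_mul, ← hb]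
  exact b_sq hcen hK2 he₀ hf₀ hh₁ ht hl hτ hu hb

include hcen hK2 ht hl hu hb in
/-- `[u, b] = 1`, hence `u b u⁻¹ = b`. [cite: Beyl1986, Theorem (Schur multiplier of SL(2,ℤ/m)), 2-primary
part] -/
theorem comm_u_b : ⁅u, b⁆ = 1 := by
  have hbc := comm_b_central hcen ht hl hu hb
  rw [hu, pow_two, comm_mul_left_of_central hbc, ← pow_two]
  exact hK2 _ (by
    rw [map_commutatorElement, commutatorElement_eq_one_iff_mul_comm]
    exact scalar_comm (π b) (coe_map_b ht hl hu hb) (π l))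

include hcen hK2 ht hl hu hd hy in
/-- `[u, y] = 1`. [cite: Beyl1986, Theorem (Schur multiplier of SL(2,ℤ/m)), 2-primary part] -/
theorem comm_u_y : ⁅u, y⁆ = 1 := by
  have hyc := comm_y_central hcen ht hl hu hd hy
  rw [hu, pow_two, comm_mul_left_of_central hyc, ← pow_two]
  exact hK2 _ (by
    rw [map_commutatorElement, commutatorElement_eq_one_iff_mul_comm]
    exact scalar_comm (π y) (coe_map_y ht hl hu hd hy) (π l))

include hcen hu hd hy ht hl in
/-- `[d, y] = 1`: `d` is itself a commutator. [cite: Beyl1986, Theorem (Schur multiplier of SL(2,ℤ/m)), 2-primary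
part] -/
theorem comm_d_y : ⁅d, y⁆ = 1 := by
  have hyc := comm_y_central hcen ht hl hu hd hy
  conv_lhs => rw [hd]
  exact comm_comm_eq_one_of_central hyc t u

include hcen hK2 he₀ hf₀ hh₁ ht hl hτ hu hb in
/-- **`[t, h₁] = 1`**: conjugation by `t` fixes `h₁ = x₀ f₀⁻¹ e₀` (`x₀ = t f₀ t⁻¹`), because `t x₀ t⁻¹ = [t², f₀] f₀ =
b² f₀ = f₀` and `f₀² = x₀² = 1` in the abelian layer. [cite: Beyl1986, Theorem (Schur multiplier of SL(2,ℤ/m)),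
2-primary part] -/
theorem comm_t_h₁ : ⁅t, h₁⁆ = 1 := by
  haveI : Fact (Nat.Prime 2) := ⟨Nat.prime_two⟩
  have hub := comm_u_b hcen hK2 ht hl hu hb
  have hbb := b_sq hcen hK2 he₀ hf₀ hh₁ ht hl hτ hu hb
  have hfu : f₀ = u * u := by rw [f₀_eq hf₀, hu, pow_two]
  -- `[t², f₀] = b · u b u⁻¹ = b² = 1`
  have h1 : ⁅t ^ 2, f₀⁆ = 1 := by
    rw [hfu, comm_mul_right, ← hb]
    have : u * b * u⁻¹ = b := by
      rw [← mul_inv_eq_one, show u * b * u⁻¹ * b⁻¹ = ⁅u, b⁆ from (commutatorElement_def u b).symm, hub]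
    rw [this, hbb]
  have h2 : t * (t * f₀ * t⁻¹) * t⁻¹ = f₀ := by
    have : t * (t * f₀ * t⁻¹) * t⁻¹ = ⁅t ^ 2, f₀⁆ * f₀ := by rw [commutatorElement_def, pow_two]; group
    rw [this, h1, one_mul]
  -- squares in the layer
  have hlay_f := SL2CentralExtension.layer_f₀ (π := π) hf₀ hl
  have hlay_x : Matrix.SpecialLinearGroup.map (ZMod.castHom (pow_dvd_pow 2 (Nat.sub_le 3 1))
      (ZMod (2 ^ (3 - 1)))) (π (t * f₀ * t⁻¹)) = 1 := by
    rw [map_mul, map_mul, map_mul, map_mul, hlay_f, mul_one, map_inv, map_inv, mul_inv_cancel]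
  have hf2 := sq_eq_one_of_layer hcen hK2 he₀ hf₀ hh₁ ht hl hτ hlay_f
  have hx2 := sq_eq_one_of_layer hcen hK2 he₀ hf₀ hh₁ ht hl hτ hlay_x
  have hxf : (t * f₀ * t⁻¹) * f₀ = f₀ * (t * f₀ * t⁻¹) := comm_of_layer hcen hK2 he₀ hf₀ hh₁ ht hl hlay_x hlay_f
  have het : t * e₀ * t⁻¹ = e₀ := by rw [e₀_eq he₀]; group
  -- `t h₁ t⁻¹ = f₀ x₀⁻¹ e₀ = x₀ f₀⁻¹ e₀ = h₁`
  have hfinv : f₀⁻¹ = f₀ := by rw [inv_eq_iff_mul_eq_one, hf2]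
  have hxinv : (t * f₀ * t⁻¹)⁻¹ = t * f₀ * t⁻¹ := by rw [inv_eq_iff_mul_eq_one, hx2]
  rw [commutatorElement_eq_one_iff_mul_comm]
  calc t * h₁ = t * h₁ * t⁻¹ * t := by group
    _ = (t * (t * f₀ * t⁻¹) * t⁻¹) * (t * f₀ * t⁻¹)⁻¹ * (t * e₀ * t⁻¹) * t := by rw [hh₁]; group
    _ = f₀ * (t * f₀ * t⁻¹) * e₀ * t := by rw [h2, hxinv, het]
    _ = (t * f₀ * t⁻¹) * f₀ * e₀ * t := by rw [hxf]
    _ = (t * f₀ * t⁻¹) * f₀⁻¹ * e₀ * t := by rw [hfinv]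
    _ = h₁ * t := by rw [hh₁]

include hcen hK2 he₀ hf₀ hh₁ ht hl hτ hu hd hy hb in
/-- `[t, y] = 1`. [cite: Beyl1986, Theorem (Schur multiplier of SL(2,ℤ/m)), 2-primary part] -/
theorem comm_t_y : ⁅t, y⁆ = 1 := by
  obtain ⟨k, hk, hyk⟩ := SL2CentralExtension.exists_eq_mul_of_map_eq (π := π) (x := y) (y := h₁)
    (Subtype.ext (by rw [coe_map_y ht hl hu hd hy, coe_map_h₁ he₀ hf₀ hh₁ ht hl]))
  rw [hyk, comm_mul_right, comm_t_h₁ hcen hK2 he₀ hf₀ hh₁ ht hl hτ hu hb, one_mul,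
    (commutatorElement_eq_one_iff_mul_comm.mpr (hcen k hk t)), mul_one, mul_inv_cancel]

include hcen hK2 he₀ hf₀ hh₁ ht hl hτ hu hd hb in
/-- `[e₀, d] = 1`. [cite: Beyl1986, Theorem (Schur multiplier of SL(2,ℤ/m)), 2-primary part] -/
theorem comm_e₀_d : ⁅e₀, d⁆ = 1 := by
  have hc0 := comm_e₀_u hcen hK2 he₀ hf₀ hh₁ ht hl hτ hu hb
  have hdd : d = (t * u * t⁻¹) * u⁻¹ := by rw [hd, commutatorElement_def]
  have het : Commute e₀ t := by rw [e₀_eq he₀]; exact (Commute.refl t).pow_left 4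
  have h1 : ⁅e₀, t * u * t⁻¹⁆ = 1 := by
    have : ⁅e₀, t * u * t⁻¹⁆ = t * ⁅e₀, u⁆ * t⁻¹ := by
      rw [commutatorElement_def, commutatorElement_def]
      have := het.eq
      calc e₀ * (t * u * t⁻¹) * e₀⁻¹ * (t * u * t⁻¹)⁻¹
          = (e₀ * t) * u * (t⁻¹ * e₀⁻¹) * t * u⁻¹ * t⁻¹ := by group
        _ = (t * e₀) * u * (e₀⁻¹ * t⁻¹) * t * u⁻¹ * t⁻¹ := by
            rw [this, show t⁻¹ * e₀⁻¹ = e₀⁻¹ * t⁻¹ by rw [← mul_inv_rev, ← mul_inv_rev, this]]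
        _ = t * (e₀ * u * e₀⁻¹ * u⁻¹) * t⁻¹ := by group
    rw [this, hc0]; group
  have h2 : ⁅e₀, u⁻¹⁆ = 1 := by
    have : ⁅e₀, u⁻¹⁆ = u⁻¹ * ⁅e₀, u⁆⁻¹ * u := by rw [commutatorElement_def, commutatorElement_def]; group
    rw [this, hc0]; group
  rw [hdd, comm_mul_right, h1, h2]; group

include hh₁ hu hd hy hf₀ in
/-- The relation `d y d = h₁ e₀⁻¹` (both equal `[t, u²] = [t, f₀]`). [cite: Beyl1986, Theorem (Schur multiplier
of SL(2,ℤ/m)), 2-primary part] -/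
theorem d_y_d : d * (y * d) = h₁ * e₀⁻¹ := by
  have hfu : f₀ = u * u := by rw [f₀_eq hf₀, hu, pow_two]
  have h1 : ⁅t, u * u⁆ = d * (y * d) := by
    rw [comm_mul_right, ← hd, hy, commutatorElement_def u d]; group
  have h2 : ⁅t, f₀⁆ = h₁ * e₀⁻¹ := by rw [hh₁, commutatorElement_def]; group
  rw [← h1, ← hfu, h2]

include hd hb in
/-- `t d t⁻¹ = b d⁻¹` (pure consequence of the definitions). [cite: Beyl1986, Theorem (Schur multiplier of
SL(2,ℤ/m)), 2-primary part] -/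
theorem t_conj_d : t * d * t⁻¹ = b * d⁻¹ := by
  rw [hd, hb, commutatorElement_def, commutatorElement_def, pow_two]; group


include hcen hK2 he₀ hf₀ hh₁ ht hl hτ hu hd hy hb in
/-- **`y = b`**, using the lift `δ = u₁ t² (u³ e₀)⁻¹` (`u₁ = t u t⁻¹`) of the central scalar `3·1`
(`T̄ U T̄⁻¹ T̄² = 3·U³ T̄⁴`): `y b⁻¹ = [u, u₁ t²] = [u, δ u³ e₀] = 1`. [cite: Beyl1986, Theorem (Schur multiplier of
SL(2,ℤ/m)), 2-primary part] -/
theorem y_eq_b : y = b := by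
  have hc0 := comm_e₀_u hcen hK2 he₀ hf₀ hh₁ ht hl hτ hu hb
  have hbc := comm_b_central hcen ht hl hu hb
  have hub := comm_u_b hcen hK2 ht hl hu hb
  set u₁ : E := t * u * t⁻¹ with hu₁
  set δ : E := u₁ * t ^ 2 * (u ^ 3 * e₀)⁻¹ with hδ
  have hδcoe : ((π δ : SL(2, ZMod (2 ^ 3))) : Matrix (Fin 2) (Fin 2) (ZMod (2 ^ 3))) = !![3, 0; 0, 3] := by
    have h6 : π u ^ 3 = π l ^ 6 := by rw [hu, map_pow, ← pow_mul]
    rw [hδ, hu₁, e₀_eq he₀]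
    simp only [map_mul, map_inv, map_pow]
    rw [h6, hu, map_pow]
    exact coe_conj_rel (π t) (π l) ht hl
  have hδc : ∀ g h : E, h * ⁅g, δ⁆ = ⁅g, δ⁆ * h :=
    comm_central_of_map_central hcen (fun g' ↦ scalar_comm (π δ) hδcoe g')
  have hrel : u₁ * t ^ 2 = δ * (u ^ 3 * e₀) := by rw [hδ]; group
  have hy' : y = ⁅u, u₁⁆ := by rw [hy, hd, hu₁]; simp only [commutatorElement_def]; group
  -- `[u₁, b] = 1`
  have hu₁b : ⁅u₁, b⁆ = 1 := by
    rw [hu₁, comm_mul_left_of_central hbc, comm_mul_left_of_central hbc, comm_inv_left_of_central hbc, hub,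
      mul_one, mul_inv_cancel]
  -- `[u, u₁ t²] = y b⁻¹`
  have h1 : ⁅u, u₁ * t ^ 2⁆ = y * b⁻¹ := by
    rw [comm_mul_right, ← hy', ← commutatorElement_inv, ← hb]
    have : u₁ * b⁻¹ * u₁⁻¹ = b⁻¹ := by
      have h := (commutatorElement_eq_one_iff_mul_comm.mp hu₁b)  -- u₁ * b = b * u₁
      calc u₁ * b⁻¹ * u₁⁻¹ = b⁻¹ * (b * u₁) * b⁻¹ * u₁⁻¹ := by group
        _ = b⁻¹ * (u₁ * b) * b⁻¹ * u₁⁻¹ := by rw [h]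
        _ = b⁻¹ := by group
    rw [this]
  -- `[u, u₁ t²] = 1`
  have h2 : ⁅u, u₁ * t ^ 2⁆ = 1 := by
    have huδ : ⁅u, δ⁆ = 1 := by
      rw [hu, pow_two, comm_mul_left_of_central hδc, ← pow_two]
      exact hK2 _ (by
        rw [map_commutatorElement, commutatorElement_eq_one_iff_mul_comm]
        exact scalar_comm (π δ) hδcoe (π l))
    have hue : ⁅u, e₀⁆ = 1 := by rw [← commutatorElement_inv, hc0, inv_one]
    have huu : ⁅u, u ^ 3⁆ = 1 := commutatorElement_eq_one_iff_commute.mpr ((Commute.refl u).pow_right 3)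
    rw [hrel, comm_mul_right, huδ, one_mul, comm_mul_right, huu, one_mul, hue]
    group
  rw [h1] at h2
  exact mul_inv_eq_one.mp h2

include hcen hu hd hy ht hl in
/-- `d` and `y` commute. [cite: Beyl1986, Theorem (Schur multiplier of SL(2,ℤ/m)), 2-primary part] -/
theorem commute_d_y : Commute d y :=
  commutatorElement_eq_one_iff_commute.mp (comm_d_y hcen ht hl hu hd hy)

include hcen hK2 he₀ hf₀ hh₁ ht hl hτ hu hd hy in
/-- `d² = y⁻¹ (h₁ e₀⁻¹)` lies over the top layer, hence **`d⁴ = 1`**. [cite: Beyl1986, Theorem (Schur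
multiplier of SL(2,ℤ/m)), 2-primary part] -/
theorem d_pow_four : d ^ 4 = 1 := by
  haveI : Fact (Nat.Prime 2) := ⟨Nat.prime_two⟩
  have hdy := (commute_d_y hcen ht hl hu hd hy).eq
  have h1 : d * d = y⁻¹ * (h₁ * e₀⁻¹) := by
    have h := d_y_d hf₀ hh₁ hu hd hy
    rw [← mul_assoc, hdy, mul_assoc] at h
    rw [← h, inv_mul_cancel_left]
  have hlay : Matrix.SpecialLinearGroup.map (ZMod.castHom (pow_dvd_pow 2 (Nat.sub_le 3 1)) (ZMod (2 ^ (3 - 1))))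
      (π (d * d)) = 1 := by
    rw [h1]
    simp only [map_mul, map_inv, layer_of_coe_five (coe_map_y ht hl hu hd hy),
      SL2CentralExtension.layer_h₁ (π := π) he₀ hf₀ hh₁ ht hl (by norm_num : 2 ≤ 3),
      SL2CentralExtension.layer_e₀ (π := π) he₀ ht, inv_one, one_mul]
  have h2 := sq_eq_one_of_layer hcen hK2 he₀ hf₀ hh₁ ht hl hτ hlay
  rw [show d ^ 4 = d * d * (d * d) by simp only [pow_succ, pow_zero, one_mul, mul_assoc], h2]

include hcen hK2 he₀ hf₀ hh₁ ht hl hτ hu hd hy hb in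
/-- **`t d t⁻¹ = y d³`.** [cite: Beyl1986, Theorem (Schur multiplier of SL(2,ℤ/m)), 2-primary part] -/
theorem t_conj_d' : t * d * t⁻¹ = y * d ^ 3 := by
  have hd4 := d_pow_four hcen hK2 he₀ hf₀ hh₁ ht hl hτ hu hd hy
  have hdinv : d⁻¹ = d ^ 3 := by
    rw [inv_eq_iff_mul_eq_one, ← pow_succ', hd4]
  rw [t_conj_d hd hb, ← y_eq_b hcen hK2 he₀ hf₀ hh₁ ht hl hτ hu hd hy hb, hdinv]

include hy in
/-- `u d u⁻¹ = y d`. [cite: Beyl1986, Theorem (Schur multiplier of SL(2,ℤ/m)), 2-primary part] -/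
theorem u_conj_d : u * d * u⁻¹ = y * d := by rw [hy, commutatorElement_def]; group

include hcen hK2 he₀ hf₀ hh₁ ht hl hτ hu hd hy hb in
/-- `t y t⁻¹ = y`. [cite: Beyl1986, Theorem (Schur multiplier of SL(2,ℤ/m)), 2-primary part] -/
theorem t_conj_y : t * y * t⁻¹ = y := by
  have h := commutatorElement_eq_one_iff_mul_comm.mp (comm_t_y hcen hK2 he₀ hf₀ hh₁ ht hl hτ hu hd hy hb)
  rw [h, mul_inv_cancel_right]

include hcen hK2 ht hl hu hd hy in
/-- `u y u⁻¹ = y`. [cite: Beyl1986, Theorem (Schur multiplier of SL(2,ℤ/m)), 2-primary part] -/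
theorem u_conj_y : u * y * u⁻¹ = y := by
  have h := commutatorElement_eq_one_iff_mul_comm.mp (comm_u_y hcen hK2 ht hl hu hd hy)
  rw [h, mul_inv_cancel_right]

include hcen hK2 he₀ hf₀ hh₁ ht hl hτ hu hd hy hb in
/-- `t⁻¹ d t = y d³` as well. [cite: Beyl1986, Theorem (Schur multiplier of SL(2,ℤ/m)), 2-primary part] -/
theorem tinv_conj_d : t⁻¹ * d * t = y * d ^ 3 := by
  have hd4 := d_pow_four hcen hK2 he₀ hf₀ hh₁ ht hl hτ hu hd hy
  have hy2 := y_sq hcen hK2 he₀ hf₀ hh₁ ht hl hτ hu hd hy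
  have htd := t_conj_d' hcen hK2 he₀ hf₀ hh₁ ht hl hτ hu hd hy hb
  have hty := t_conj_y hcen hK2 he₀ hf₀ hh₁ ht hl hτ hu hd hy hb
  have hdy := commute_d_y hcen ht hl hu hd hy
  -- `t (y d³) t⁻¹ = y (y d³)³ = d`
  have h1 : t * (y * d ^ 3) * t⁻¹ = d := by
    have h2 : t * (y * d ^ 3) * t⁻¹ = (t * y * t⁻¹) * (t * d * t⁻¹) ^ 3 := by rw [conj_pow]; group
    rw [h2, hty, htd, (hdy.symm.pow_right 3).mul_pow, ← pow_mul]
    calc y * (y ^ 3 * d ^ (3 * 3)) = (y * y) * (y * y) * (d ^ 4 * d ^ 4) * d := by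
          simp only [pow_succ, pow_zero, one_mul, Nat.reduceMul, mul_assoc]
      _ = d := by rw [hy2, hd4]; group
  calc t⁻¹ * d * t = t⁻¹ * (t * (y * d ^ 3) * t⁻¹) * t := by rw [h1]
    _ = y * d ^ 3 := by group


include hcen hK2 he₀ hf₀ hh₁ ht hl hτ hu hd hy in
/-- `u⁻¹ d u = y d`. [cite: Beyl1986, Theorem (Schur multiplier of SL(2,ℤ/m)), 2-primary part] -/
theorem uinv_conj_d : u⁻¹ * d * u = y * d := by
  have huy := u_conj_y hcen hK2 ht hl hu hd hy
  have hud := u_conj_d (u := u) (d := d) hy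
  have hy2 := y_sq hcen hK2 he₀ hf₀ hh₁ ht hl hτ hu hd hy
  have h1 : u * (y * d) * u⁻¹ = d := by
    calc u * (y * d) * u⁻¹ = (u * y * u⁻¹) * (u * d * u⁻¹) := by group
      _ = y * (y * d) := by rw [huy, hud]
      _ = (y * y) * d := by group
      _ = d := by rw [hy2, one_mul]
  calc u⁻¹ * d * u = u⁻¹ * (u * (y * d) * u⁻¹) * u := by rw [h1]
    _ = y * d := by group

end levelEight

end SL2Mod8

end Literature.GroupTheory.ArithmeticGroups
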